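import Mathlib.RingTheory.Ideal.GoingDown
import Mathlib.RingTheory.TensorProduct.MvPolynomial
import Mathlib.RingTheory.Flat.Stability
import Mathlib.FieldTheory.IntermediateField.Adjoin.Algebra
import Mathlib.FieldTheory.IntermediateField.Algebraic
import Mathlib.FieldTheory.AlgebraicClosure
import Literature.RingTheory.KrullDimension.BaseChangeDimension
import Literature.NumberTheory.Transcendental.ExpVarietiesDimension
import HarnessLib

/-!
# Components of the base change of a `k`-variety: dimension, rotundity, freeness, genericity

Commutative-algebra toolkit for applying Zilber's strong exponential-algebraic closedness
(`Literature.NumberTheory.Transcendental.IsStronglyExpAlgClosed`, whose varieties are irreducible closed subsets `W ⊆ F^{n ⊕ n}` *over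
the big algebraically closed field `F`*, rotund and free, of prescribed `Literature.NumberTheory.Transcendental.zariskiDim`) to the
locus of a point over a *subfield* `k ⊆ F` — the situation of Bays–Kirby 2018, Lemma 8.3 ("by
axiom 4 applied to an absolutely irreducible component of `V = loc(b/A)`"). Given a prime ideal
`P ⊆ k[X, Y]` (`X, Y` indexed by `Fin n`), we consider the extended ideal `P·F[X, Y]` and any
minimal prime `Q` over it (such `Q` exist, `exists_mem_minimalPrimes_map`, since `F[X,Y]` is
faithfully flat over `k[X,Y]`); `Z(Q) ⊆ F^{n ⊕ n}` is an irreducible component of `Z(P)_F`. We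
prove, for every such component:

* `under_eq_of_mem_minimalPrimes_map` — `Q ∩ k[X,Y] = P` (going-down for the flat extension
  `k[X,Y] → F[X,Y]`), so `k[Z(P)] = k[X,Y]⧸P ↪ F[X,Y]⧸Q` and `k(Z(P)) ↪ F(Z(Q))` (`funcMap`),
  generic point to generic point (`funcMap_genericPt`);
* `ringKrullDim_quotient_eq_of_mem_minimalPrimes_map`, `zariskiDim_component` —
  `dim Z(Q) = dim k[X,Y]⧸P` (every component of a base change has the dimension of the variety:
  `Literature.RingTheory.KrullDimension.ringKrullDim_quotient_eq_of_isPushout_of_mem_minimalPrimes`, Görtz–Wedhorn I Prop. 5.38);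
* `algebraicIndependent_funcMap` — **transport of algebraic independence**: elements of `k(Z(P))`
  algebraically independent over `k` stay algebraically independent over `F` in `F(Z(Q))`
  (extend to a transcendence basis `T`, `#T = dim`; `F(Z(Q))` is algebraic over `F(T)` and has
  transcendence degree `dim`);
* consequently the geometric hypotheses of `IsStronglyExpAlgClosed` for `W = Z(Q)` (irreducible,
  meets `Gⁿ`, rotund, free, dimension — not the finitely generated field of definition, which any
  Zariski closed set has, `Literature.NumberTheory.Transcendental.IsZariskiClosed.exists_isDefinedOver`) follow from data about the
  generic point `ζ` of `Z(P)` over `k`: `component_inter_torusLocus_nonempty` (`Yᵢ ∉ P`),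
  `isRotund_component` (`rk M` coordinates of `[M] ζ` algebraically independent over `k`, for
  each `M` — Bays–Kirby 2018, proof of Prop. 7.3: `dim (M·V)^{Zar} = td(M·b/A)`),
  `isAddFree_component` / `isMulFree_component` (non-trivial `ℤ`-combinations of the additive
  coordinates, resp. Laurent monomials in the multiplicative coordinates, of `ζ` transcendental
  over `k`), `isIrreducibleClosed_component`, `zeroLocus_subset_zeroLocus` (`Z(Q) ⊆ Z(P)`);
* `liftOfIsGenericPt`, `algebraicIndependent_matrixAct_genericPt`, … — the data may be verified
  on any generic point of `Z(P)` in any field (e.g. the point of `F` whose locus `P` is);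
* `funcFieldEquiv`, `algebraicIndependent_matrixAct_genericPt_mapCoeff`, … — and transported
  along an isomorphism `θ : k ≃ k'` of coefficient fields to `P^θ ⊆ k'[X,Y]`;
* `isGenericPt_of_trdeg_le` — **genericity from transcendence degree**: a zero `z ∈ Z(P)(F)` with
  `trdeg_k k[z] ≥ trdeg_k k[X,Y]⧸P` has `I(z/k) = P` (Bays–Kirby 2018, proof of Lemma 8.3: "so
  `td(c/A) = dim V`; thus `c` is generic in `V` over `A`"; via `Literature.RingTheory.KrullDimension.trdeg_quotient_lt`).

All of this is standard (Görtz–Wedhorn I §5; Bays–Kirby 2018 §7); it is the algebraic-geometry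
glue of the proof of `Literature.NumberTheory.Transcendental.BaysKirby2018_saturation_of_isStronglyExpAlgClosed`.

## References

* U. Görtz, T. Wedhorn, *Algebraic Geometry I*, 2nd ed. (2020), Prop. 5.38, Exercise 5.12.
* M. Bays, J. Kirby, *Pseudo-exponential maps, variants, and quasiminimality*, Algebra & Number
  Theory 12 (2018): Prop. 7.3 (proof), Lemma 8.3 (proof).
* B. Zilber, *Pseudo-exponentiation on algebraically closed fields of characteristic zero*,
  Ann. Pure Appl. Logic 132 (2005), §3 (generic points, loci).
-/

noncomputable section

open MvPolynomial Set

universe u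

namespace Literature.NumberTheory.Transcendental

namespace LocusComponents

variable {k F : Type u} [Field k] [Field F] [Algebra k F] {ι : Type}

attribute [local instance] MvPolynomial.algebraMvPolynomial

/-! ### Contraction and dimension of minimal primes over `P·F[X]` -/

/-- `F[X]` is flat over `k[X]` (base change of the flat `k`-module `F`). [folklore] -/
theorem flat_mvPolynomial : Module.Flat (MvPolynomial ι k) (MvPolynomial ι F) :=
  Module.Flat.isBaseChange k (MvPolynomial ι k) F (MvPolynomial ι F)
    (Algebra.IsPushout.out (R := k) (S := MvPolynomial ι k) (R' := F) (S' := MvPolynomial ι F))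

/-- **A minimal prime over `P·F[X]` contracts to `P`** (`P` a prime of `k[X]`): by going-down for
the flat extension `k[X] → F[X]` there is a prime `Q₀ ⊆ Q` over `P`; it contains `P·F[X]`, so
`Q₀ = Q` by minimality. [folklore] -/
theorem under_eq_of_mem_minimalPrimes_map {P : Ideal (MvPolynomial ι k)} [P.IsPrime]
    {Q : Ideal (MvPolynomial ι F)}
    (hQ : Q ∈ (P.map (algebraMap (MvPolynomial ι k) (MvPolynomial ι F))).minimalPrimes) :
    Q.under (MvPolynomial ι k) = P := by
  haveI : Q.IsPrime := hQ.1.1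
  haveI := flat_mvPolynomial (k := k) (F := F) (ι := ι)
  have hPQ : P ≤ Q.under (MvPolynomial ι k) := by
    rw [← Ideal.map_le_iff_le_comap]
    exact hQ.1.2
  obtain ⟨Q₀, hQ₀Q, hQ₀, hQ₀P⟩ :=
    Ideal.exists_ideal_le_liesOver_of_le (p := P) (q := Q.under (MvPolynomial ι k)) Q hPQ
  have hPQ₀ : P.map (algebraMap (MvPolynomial ι k) (MvPolynomial ι F)) ≤ Q₀ := by
    rw [Ideal.map_le_iff_le_comap, ← Ideal.under_def, ← hQ₀P.over]
  have : Q₀ = Q := le_antisymm hQ₀Q (hQ.2 ⟨hQ₀, hPQ₀⟩ hQ₀Q)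
  rw [← this]
  exact hQ₀P.over.symm

/-- A minimal prime over `P·F[X]` is minimal over `(Q ∩ k[X])·F[X]` as well. [folklore] -/
theorem mem_minimalPrimes_map_under {P : Ideal (MvPolynomial ι k)} [P.IsPrime]
    {Q : Ideal (MvPolynomial ι F)}
    (hQ : Q ∈ (P.map (algebraMap (MvPolynomial ι k) (MvPolynomial ι F))).minimalPrimes) :
    Q ∈ ((Q.under (MvPolynomial ι k)).map
      (algebraMap (MvPolynomial ι k) (MvPolynomial ι F))).minimalPrimes := by
  rw [under_eq_of_mem_minimalPrimes_map hQ]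
  exact hQ

/-- **Components of `Z(P)_F` have the dimension of `Z(P)`**: for a prime `P ⊆ k[X]` (finitely many
variables) and a minimal prime `Q` over `P·F[X]`, `dim F[X] ⧸ Q = dim k[X] ⧸ P`
(Görtz–Wedhorn I, Prop. 5.38 / Exercise 5.12, via
`Literature.RingTheory.KrullDimension.ringKrullDim_quotient_eq_of_isPushout_of_mem_minimalPrimes`).
[cite: GortzWedhorn2020, Prop. 5.38 and Exercise 5.12] -/
theorem ringKrullDim_quotient_eq_of_mem_minimalPrimes_map [Finite ι]
    {P : Ideal (MvPolynomial ι k)} [P.IsPrime] {Q : Ideal (MvPolynomial ι F)}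
    (hQ : Q ∈ (P.map (algebraMap (MvPolynomial ι k) (MvPolynomial ι F))).minimalPrimes) :
    ringKrullDim (MvPolynomial ι F ⧸ Q) = ringKrullDim (MvPolynomial ι k ⧸ P) := by
  haveI : Q.IsPrime := hQ.1.1
  have h := Literature.RingTheory.KrullDimension.ringKrullDim_quotient_eq_of_isPushout_of_mem_minimalPrimes (k := k) (L := F)
    (R := MvPolynomial ι k) (R' := MvPolynomial ι F) Q (mem_minimalPrimes_map_under hQ)
  rwa [under_eq_of_mem_minimalPrimes_map hQ] at h

/-- The map `k[X] ⧸ P → F[X] ⧸ Q` induced by coefficient extension, for `Q ⊇ P·F[X]`.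
[folklore] -/
def quotientMapOfLE {P : Ideal (MvPolynomial ι k)} {Q : Ideal (MvPolynomial ι F)}
    (h : P.map (algebraMap (MvPolynomial ι k) (MvPolynomial ι F)) ≤ Q) :
    MvPolynomial ι k ⧸ P →+* MvPolynomial ι F ⧸ Q :=
  Ideal.quotientMap Q (algebraMap (MvPolynomial ι k) (MvPolynomial ι F))
    (Ideal.map_le_iff_le_comap.1 h)

/-- `quotientMapOfLE` on classes. [folklore] -/
@[simp] theorem quotientMapOfLE_mk {P : Ideal (MvPolynomial ι k)} {Q : Ideal (MvPolynomial ι F)}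
    (h : P.map (algebraMap (MvPolynomial ι k) (MvPolynomial ι F)) ≤ Q) (f : MvPolynomial ι k) :
    quotientMapOfLE h (Ideal.Quotient.mk P f) =
      Ideal.Quotient.mk Q (MvPolynomial.map (algebraMap k F) f) := rfl

/-- For a minimal prime `Q` over `P·F[X]`, the map `k[X] ⧸ P → F[X] ⧸ Q` is injective
(`Q ∩ k[X] = P`). [folklore] -/
theorem quotientMapOfLE_injective {P : Ideal (MvPolynomial ι k)} [P.IsPrime]
    {Q : Ideal (MvPolynomial ι F)}
    (hQ : Q ∈ (P.map (algebraMap (MvPolynomial ι k) (MvPolynomial ι F))).minimalPrimes) :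
    Function.Injective (quotientMapOfLE hQ.1.2) := by
  rw [injective_iff_map_eq_zero]
  intro a ha
  obtain ⟨f, rfl⟩ := Ideal.Quotient.mk_surjective a
  rw [quotientMapOfLE_mk, Ideal.Quotient.eq_zero_iff_mem] at ha
  rw [Ideal.Quotient.eq_zero_iff_mem, ← under_eq_of_mem_minimalPrimes_map hQ, Ideal.mem_comap]
  exact ha

/-! ### Function fields: `k(Z(P)) → F(Z(Q))` -/

section FunctionField

variable {n : ℕ} {P : Ideal (MvPolynomial (Fin n ⊕ Fin n) k)} [P.IsPrime]
  {Q : Ideal (MvPolynomial (Fin n ⊕ Fin n) F)} [Q.IsPrime]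
  (hQ : Q ∈ (P.map (algebraMap (MvPolynomial (Fin n ⊕ Fin n) k)
    (MvPolynomial (Fin n ⊕ Fin n) F))).minimalPrimes)

/-- The embedding of function fields `k(Z(P)) → F(Z(Q))` for a component `Z(Q)` of `Z(P)_F`.
[folklore] -/
def funcMap : zeroLocusFunctionField P →+* zeroLocusFunctionField Q :=
  IsLocalization.map (M := nonZeroDivisors (zeroLocusCoordRing P)) (zeroLocusFunctionField Q)
    (quotientMapOfLE hQ.1.2)
    (nonZeroDivisors_le_comap_nonZeroDivisors_of_injective _ (quotientMapOfLE_injective hQ))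

include hQ in
/-- `funcMap` extends the map of coordinate rings. [folklore] -/
theorem funcMap_algebraMap (a : zeroLocusCoordRing P) :
    funcMap hQ (algebraMap (zeroLocusCoordRing P) (zeroLocusFunctionField P) a) =
      algebraMap (zeroLocusCoordRing Q) (zeroLocusFunctionField Q) (quotientMapOfLE hQ.1.2 a) :=
  IsLocalization.map_eq _ _

/-- `funcMap` sends the generic point of `Z(P)` to the generic point of `Z(Q)`. [folklore] -/
theorem funcMap_genericPt (j : Fin n ⊕ Fin n) :
    funcMap hQ (genericPt P j) = genericPt Q j := by
  simp only [genericPt, funcMap_algebraMap, quotientMapOfLE_mk, map_X]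

/-- `funcMap` is compatible with the scalars `k → F`. [folklore] -/
theorem funcMap_algebraMap_base (c : k) :
    funcMap hQ (algebraMap k (zeroLocusFunctionField P) c) =
      algebraMap F (zeroLocusFunctionField Q) (algebraMap k F c) := by
  rw [IsScalarTower.algebraMap_apply k (zeroLocusCoordRing P) (zeroLocusFunctionField P),
    funcMap_algebraMap, IsScalarTower.algebraMap_apply F (zeroLocusCoordRing Q) (zeroLocusFunctionField Q)]
  congr 1
  have h1 : algebraMap k (zeroLocusCoordRing P) c = Ideal.Quotient.mk P (C c) := rfl
  have h2 : algebraMap F (zeroLocusCoordRing Q) (algebraMap k F c) =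
      Ideal.Quotient.mk Q (C (algebraMap k F c)) := rfl
  rw [h1, h2, quotientMapOfLE_mk, map_C]

/-- `funcMap ∘ genericPt P = genericPt Q` as functions. [folklore] -/
theorem funcMap_comp_genericPt : (funcMap hQ) ∘ genericPt P = genericPt Q :=
  funext (funcMap_genericPt hQ)

end FunctionField

/-! ### Transport of algebraic independence along `k(Z(P)) → F(Z(Q))` -/

section Transport

open scoped IntermediateField.algebraAdjoinAdjoin
open Cardinal

variable {n : ℕ} {P : Ideal (MvPolynomial (Fin n ⊕ Fin n) k)} [P.IsPrime]
  {Q : Ideal (MvPolynomial (Fin n ⊕ Fin n) F)} [Q.IsPrime]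
  (hQ : Q ∈ (P.map (algebraMap (MvPolynomial (Fin n ⊕ Fin n) k)
    (MvPolynomial (Fin n ⊕ Fin n) F))).minimalPrimes)

include hQ in
/-- **The common dimension**: there is `d : ℕ` with `dim k[X]⧸P = dim F[X]⧸Q = d` and
`trdeg_k k(Z(P)) = trdeg_F F(Z(Q)) = d`. [cite: GortzWedhorn2020, Prop. 5.38 and Exercise 5.12] -/
theorem exists_nat_dim_eq :
    ∃ d : ℕ, ringKrullDim (zeroLocusCoordRing P) = d ∧ ringKrullDim (zeroLocusCoordRing Q) = d ∧
      Algebra.trdeg k (zeroLocusFunctionField P) = d ∧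
      Algebra.trdeg F (zeroLocusFunctionField Q) = d := by
  obtain ⟨d, hdA, htA⟩ := Literature.RingTheory.KrullDimension.exists_ringKrullDim_eq_and_trdeg_eq k (zeroLocusCoordRing P)
  obtain ⟨d', hdD, htD⟩ := Literature.RingTheory.KrullDimension.exists_ringKrullDim_eq_and_trdeg_eq F (zeroLocusCoordRing Q)
  have hdd : d' = d := by
    have h := ringKrullDim_quotient_eq_of_mem_minimalPrimes_map hQ
    change ringKrullDim (zeroLocusCoordRing Q) = ringKrullDim (zeroLocusCoordRing P) at h
    rw [hdA, hdD] at h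
    exact_mod_cast h
  subst hdd
  refine ⟨d', hdA, hdD, ?_, ?_⟩
  · rw [trdeg_zeroLocusFunctionField_eq, htA]
  · rw [trdeg_zeroLocusFunctionField_eq, htD]

/-- The function field `F(Z(Q))` is generated over `F` by the coordinates of the generic point:
every intermediate field containing them is everything. [folklore] -/
theorem eq_top_of_genericPt_mem {C : IntermediateField F (zeroLocusFunctionField Q)}
    (hC : ∀ j, genericPt Q j ∈ C) : C = ⊤ := by
  rw [eq_top_iff]
  intro z _
  obtain ⟨a, b, hb, rfl⟩ := IsFractionRing.div_surjective (A := zeroLocusCoordRing Q) z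
  have hmem : ∀ c : zeroLocusCoordRing Q,
      algebraMap (zeroLocusCoordRing Q) (zeroLocusFunctionField Q) c ∈ C := by
    intro c
    obtain ⟨f, rfl⟩ := Ideal.Quotient.mk_surjective c
    rw [← aeval_genericPt]
    have h1 : aeval (genericPt Q) f ∈ Algebra.adjoin F (range (genericPt Q)) :=
      by
        rw [Algebra.adjoin_range_eq_range_aeval]
        exact ⟨f, rfl⟩
    exact (Algebra.adjoin_le (S := C.toSubalgebra) (by rintro _ ⟨j, rfl⟩; exact hC j)) h1
  exact div_mem (hmem a) (hmem b)

include hQ in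
/-- **Transport of algebraic independence to a component of the base change.** If finitely many
elements of the function field `k(Z(P))` are algebraically independent over `k`, their images in
`F(Z(Q))` are algebraically independent over `F`: extend them to a transcendence basis `T` of
`k(Z(P))` (`#T = dim`); `F(Z(Q))` is generated by the image of `k[Z(P)]`, hence algebraic over
`F(image of T)`, and `trdeg_F F(Z(Q)) = dim = #T` forces the image of `T` to be a transcendence
basis. [cite: GortzWedhorn2020, Prop. 5.38 and Exercise 5.12] -/
theorem algebraicIndependent_funcMap {r : ℕ} {v : Fin r → zeroLocusFunctionField P}
    (hv : AlgebraicIndependent k v) : AlgebraicIndependent F (funcMap hQ ∘ v) := by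
  classical
  obtain ⟨d, -, -, htKA, htKD⟩ := exists_nat_dim_eq hQ
  -- a transcendence basis `T ⊇ range v`
  have hS : AlgebraicIndepOn k _root_.id (range v) := hv.to_subtype_range
  obtain ⟨T, hST, hT⟩ := exists_isTranscendenceBasis_superset hS
  have hTcard : #T = d := by rw [hT.cardinalMk_eq_trdeg, htKA]
  haveI : Finite T := Cardinal.mk_lt_aleph0_iff.1 (hTcard ▸ Cardinal.natCast_lt_aleph0 (n := d))
  set w : T → zeroLocusFunctionField Q := fun t => funcMap hQ (t : zeroLocusFunctionField P)
    with hw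
  -- `F(Z(Q))` is algebraic over `F(range w)`
  set B' : IntermediateField F (zeroLocusFunctionField Q) := IntermediateField.adjoin F (range w)
    with hB'
  set R₀ : Subalgebra k (zeroLocusFunctionField P) :=
    Algebra.adjoin k (range ((↑) : T → zeroLocusFunctionField P)) with hR₀
  haveI hR₀alg : Algebra.IsAlgebraic R₀ (zeroLocusFunctionField P) := hT.isAlgebraic
  have hmap : ∀ x ∈ R₀, funcMap hQ x ∈ B' := by
    intro x hx
    induction hx using Algebra.adjoin_induction with
    | mem x hx =>
      obtain ⟨t, rfl⟩ := hx
      exact IntermediateField.subset_adjoin F _ ⟨t, rfl⟩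
    | algebraMap c =>
      rw [funcMap_algebraMap_base]
      exact B'.algebraMap_mem _
    | add x y _ _ hx hy => rw [map_add]; exact add_mem hx hy
    | mul x y _ _ hx hy => rw [map_mul]; exact mul_mem hx hy
  let f : R₀ →+* B' :=
    ((funcMap hQ).comp (algebraMap R₀ (zeroLocusFunctionField P))).codRestrict B'
      (fun x => hmap x x.2)
  have hf : Function.Injective f := by
    intro x y hxy
    have : funcMap hQ (x : zeroLocusFunctionField P) = funcMap hQ y := by
      simpa [f] using congrArg Subtype.val hxy
    exact Subtype.ext ((funcMap hQ).injective this)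
  have hcomp : (algebraMap B' (zeroLocusFunctionField Q)).comp f =
      (funcMap hQ).comp (algebraMap R₀ (zeroLocusFunctionField P)) := by
    ext x; rfl
  have hgen : ∀ j, IsAlgebraic B' (genericPt Q j) := by
    intro j
    have h := (hR₀alg.isAlgebraic (genericPt P j)).ringHom_of_comp_eq f (funcMap hQ) hf hcomp
    rwa [funcMap_genericPt] at h
  haveI hB'alg : Algebra.IsAlgebraic B' (zeroLocusFunctionField Q) := by
    have htop : (algebraicClosure B' (zeroLocusFunctionField Q)).restrictScalars F = ⊤ :=
      eq_top_of_genericPt_mem fun j => (mem_algebraicClosure_iff).2 (hgen j)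
    refine ⟨fun z => ?_⟩
    have hz : z ∈ (algebraicClosure B' (zeroLocusFunctionField Q)).restrictScalars F := by
      rw [htop]; exact IntermediateField.mem_top
    exact (mem_algebraicClosure_iff).1 hz
  haveI halg : Algebra.IsAlgebraic (Algebra.adjoin F (range w)) (zeroLocusFunctionField Q) :=
    Algebra.IsAlgebraic.trans (Algebra.adjoin F (range w)) B' (zeroLocusFunctionField Q)
  -- so `w` is a transcendence basis
  haveI : FaithfulSMul F (zeroLocusFunctionField Q) :=
    (faithfulSMul_iff_algebraMap_injective F _).2 (algebraMap F _).injective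
  have hwT : IsTranscendenceBasis F w :=
    Algebra.IsAlgebraic.isTranscendenceBasis_of_le_trdeg_of_finite F w (by rw [hTcard, htKD])
  -- conclude
  let ι' : Fin r → T := fun i => ⟨v i, hST ⟨i, rfl⟩⟩
  have hinj : Function.Injective ι' := fun i j h =>
    hv.injective (by simpa [ι'] using congrArg Subtype.val h)
  have : funcMap hQ ∘ v = w ∘ ι' := rfl
  rw [this]
  exact hwT.1.comp _ hinj

include hQ in
/-- Transport of transcendence of a single element. [folklore] -/
theorem transcendental_funcMap {a : zeroLocusFunctionField P} (ha : Transcendental k a) :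
    Transcendental F (funcMap hQ a) := by
  have h1 : AlgebraicIndependent k ![a] := algebraicIndependent_unique_type_iff.2 (by simpa using ha)
  have h2 := algebraicIndependent_funcMap hQ h1
  have := algebraicIndependent_unique_type_iff.1 h2
  simpa using this

end Transport

/-! ### Ring homomorphisms and the torus action -/

section MapMatrixAct

variable {E E' : Type*} [Field E] [Field E'] {n : ℕ}

/-- Ring homomorphisms of fields commute with the action of integer matrices on `Eⁿ × (Eˣ)ⁿ`.
[folklore] -/
theorem map_matrixAct (ψ : E →+* E') (M : Matrix (Fin n) (Fin n) ℤ) (z : Fin n ⊕ Fin n → E) :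
    ψ ∘ matrixAct M z = matrixAct M (ψ ∘ z) := by
  funext c
  cases c with
  | inl i => simp [matrixAct_inl, map_sum, map_mul]
  | inr i => simp [matrixAct_inr, map_prod, map_zpow₀]

end MapMatrixAct

/-! ### Components of `Z(P)_F` as varieties for `Literature.NumberTheory.Transcendental.IsStronglyExpAlgClosed` -/

section Component

variable {n : ℕ} {P : Ideal (MvPolynomial (Fin n ⊕ Fin n) k)} [P.IsPrime]

/-- `F[X]` is faithfully flat over `k[X]`. [folklore] -/
theorem faithfullyFlat_mvPolynomial :
    Module.FaithfullyFlat (MvPolynomial ι k) (MvPolynomial ι F) :=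
  Module.FaithfullyFlat.of_linearEquiv _ _
    (Algebra.IsPushout.equiv k (MvPolynomial ι k) F (MvPolynomial ι F)).symm.toLinearEquiv

/-- **Components exist**: `P·F[X]` is a proper ideal (faithful flatness), so it has minimal
primes. [folklore] -/
theorem exists_mem_minimalPrimes_map :
    ∃ Q : Ideal (MvPolynomial (Fin n ⊕ Fin n) F),
      Q ∈ (P.map (algebraMap (MvPolynomial (Fin n ⊕ Fin n) k)
        (MvPolynomial (Fin n ⊕ Fin n) F))).minimalPrimes := by
  haveI := faithfullyFlat_mvPolynomial (k := k) (F := F) (ι := Fin n ⊕ Fin n)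
  obtain ⟨Q, hQ, hQP⟩ := Ideal.exists_isPrime_liesOver_of_faithfullyFlat
    (B := MvPolynomial (Fin n ⊕ Fin n) F) P
  have hle : P.map (algebraMap _ (MvPolynomial (Fin n ⊕ Fin n) F)) ≤ Q := by
    rw [Ideal.map_le_iff_le_comap, ← Ideal.under_def, ← hQP.over]
  obtain ⟨Q₀, hQ₀, -⟩ := Ideal.exists_minimalPrimes_le hle
  exact ⟨Q₀, hQ₀⟩

variable {Q : Ideal (MvPolynomial (Fin n ⊕ Fin n) F)} [Q.IsPrime]
  (hQ : Q ∈ (P.map (algebraMap (MvPolynomial (Fin n ⊕ Fin n) k)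
    (MvPolynomial (Fin n ⊕ Fin n) F))).minimalPrimes)

omit [P.IsPrime] [Q.IsPrime] in
include hQ in
/-- `Z(Q) ⊆ Z(P)_F`: every point of the component is a zero of (the coefficient extension of)
every polynomial of `P`. [folklore] -/
theorem aeval_map_eq_zero_of_mem_zeroLocus {z : Fin n ⊕ Fin n → F} (hz : z ∈ zeroLocus F Q)
    {f : MvPolynomial (Fin n ⊕ Fin n) k} (hf : f ∈ P) :
    aeval z (MvPolynomial.map (algebraMap k F) f) = 0 :=
  (mem_zeroLocus_iff.1 hz) _ (hQ.1.2 (Ideal.mem_map_of_mem _ hf))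

omit [P.IsPrime] [Q.IsPrime] in
include hQ in
/-- Points of the component are zeros of `P` (two-field zero locus: coefficients in `k`, points
in `F`). [folklore] -/
theorem zeroLocus_subset_zeroLocus : zeroLocus F Q ⊆ zeroLocus F P := by
  intro z hz
  rw [mem_zeroLocus_iff]
  intro f hf
  have := aeval_map_eq_zero_of_mem_zeroLocus hQ hz hf
  rwa [aeval_map_algebraMap] at this

omit [Q.IsPrime] in
include hQ in
/-- If `Yᵢ ∉ P` then `Yᵢ ∉ Q` (`Q ∩ k[X] = P`). [folklore] -/
theorem X_inr_notMem_component (hY : ∀ i, (X (Sum.inr i) : MvPolynomial (Fin n ⊕ Fin n) k) ∉ P)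
    (i : Fin n) : (X (Sum.inr i) : MvPolynomial (Fin n ⊕ Fin n) F) ∉ Q := by
  intro h
  apply hY i
  rw [← under_eq_of_mem_minimalPrimes_map hQ, Ideal.under_def, Ideal.mem_comap,
    MvPolynomial.algebraMap_def, map_X]
  exact h

variable [IsAlgClosed F]

include hQ in
/-- **The component meets the torus** as soon as `Z(P)` does generically (`Yᵢ ∉ P`):
`∏ Yᵢ ∉ Q`, so by the Nullstellensatz `Z(Q) ⊄ Z(∏ Yᵢ)`. [folklore] -/
theorem component_inter_torusLocus_nonempty
    (hY : ∀ i, (X (Sum.inr i) : MvPolynomial (Fin n ⊕ Fin n) k) ∉ P) :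
    (zeroLocus F Q ∩ torusLocus F n).Nonempty := by
  by_contra hne
  rw [not_nonempty_iff_eq_empty] at hne
  have hprod : (∏ i, X (Sum.inr i) : MvPolynomial (Fin n ⊕ Fin n) F) ∈
      vanishingIdeal F (zeroLocus F Q) := by
    rw [mem_vanishingIdeal_iff]
    intro z hz
    rw [map_prod]
    simp only [aeval_X]
    by_contra h0
    have hzT : z ∈ torusLocus F n := fun i hi => h0 (Finset.prod_eq_zero (Finset.mem_univ i) hi)
    have : z ∈ zeroLocus F Q ∩ torusLocus F n := ⟨hz, hzT⟩
    rw [hne] at this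
    exact this
  rw [MvPolynomial.IsPrime.vanishingIdeal_zeroLocus (K := F) Q] at hprod
  obtain ⟨i, -, hi⟩ := Ideal.IsPrime.prod_mem_iff.1 hprod
  exact X_inr_notMem_component hQ hY i hi

omit [P.IsPrime] in
/-- The component is an irreducible Zariski closed set. [folklore] -/
theorem isIrreducibleClosed_component : IsIrreducibleClosed F (zeroLocus F Q) :=
  isIrreducibleClosed_zeroLocus Q

include hQ in
/-- **Dimension of the component**: `zariskiDim F Z(Q) = dim k[X] ⧸ P`.
[cite: GortzWedhorn2020, Prop. 5.38 and Exercise 5.12] -/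
theorem zariskiDim_component :
    zariskiDim F (zeroLocus F Q) = ringKrullDim (MvPolynomial (Fin n ⊕ Fin n) k ⧸ P) := by
  rw [zariskiDim_zeroLocus_eq, ringKrullDim_quotient_eq_of_mem_minimalPrimes_map hQ]

include hQ in
/-- **Rotundity of the component from algebraically independent coordinates over `k`**
(Bays–Kirby 2018, proof of Prop. 7.3: `dim (M·V)^{Zar} = td(M·b/A) ≥ rk M`): if for every
`M ∈ Mₙ(ℤ)` some `rk M` coordinates of `[M] ζ`, `ζ` the generic point of `Z(P)` over `k`, are
algebraically independent over `k`, then `Z(Q) ∩ Gⁿ` is rotund.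
[cite: BaysKirby2018ANT, Prop. 7.3 (proof)] -/
theorem isRotund_component (hY : ∀ i, (X (Sum.inr i) : MvPolynomial (Fin n ⊕ Fin n) k) ∉ P)
    (hrot : ∀ M : Matrix (Fin n) (Fin n) ℤ,
      ∃ s : Fin (M.map (Int.cast : ℤ → ℚ)).rank → Fin n ⊕ Fin n,
        AlgebraicIndependent k fun i => matrixAct M (genericPt P) (s i)) :
    IsRotund F n (zeroLocus F Q ∩ torusLocus F n) := by
  intro M
  obtain ⟨s, hs⟩ := hrot M
  have hne := component_inter_torusLocus_nonempty hQ hY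
  refine le_zariskiDim_image_matrixAct' Q (isGenericPt_genericPt Q) hne M (fun i => X (s i)) ?_
  have h1 := algebraicIndependent_funcMap hQ hs
  have h2 : (funcMap hQ) ∘ (fun i => matrixAct M (genericPt P) (s i)) =
      fun i => matrixAct M (genericPt Q) (s i) := by
    funext i
    simp only [Function.comp_apply]
    rw [← funcMap_comp_genericPt hQ, ← map_matrixAct]
    rfl
  rw [h2] at h1
  simpa only [aeval_X] using h1

include hQ in
/-- **Additive freeness of the component**: if every non-trivial `ℤ`-combination of the additive
coordinates of the generic point `ζ` of `Z(P)` is transcendental over `k`, then `Z(Q) ∩ Gⁿ` is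
additively free — a constant value `c ∈ F` of `∑ mᵢ xᵢ` on `Z(Q) ∩ Gⁿ` would make the image of
`∑ mᵢ ζᵢ` in `F(Z(Q))` equal to `c`, hence algebraic over `F`.
[cite: BaysKirby2018ANT, Prop. 7.3 (proof)] -/
theorem isAddFree_component (hY : ∀ i, (X (Sum.inr i) : MvPolynomial (Fin n ⊕ Fin n) k) ∉ P)
    (hadd : ∀ m : Fin n → ℤ, m ≠ 0 →
      Transcendental k (∑ i, (m i : zeroLocusFunctionField P) * genericPt P (Sum.inl i))) :
    IsAddFree F n (zeroLocus F Q ∩ torusLocus F n) := by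
  intro m hm ⟨c, hc⟩
  have hne := component_inter_torusLocus_nonempty hQ hY
  -- the polynomial `∑ mᵢ Xᵢ - c` vanishes on `Z(Q) ∩ Gⁿ`, hence lies in `Q`
  set h : MvPolynomial (Fin n ⊕ Fin n) F := ∑ i, C (m i : F) * X (Sum.inl i) - C c with hh
  have hmem : h ∈ Q := by
    rw [← vanishingIdeal_zeroLocus_inter_torusLocus Q hne, mem_vanishingIdeal_iff]
    intro z hz
    simp only [hh, map_sub, map_sum, map_mul, aeval_C, aeval_X, Algebra.algebraMap_self,
      RingHom.id_apply]
    rw [hc z hz, sub_self]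
  have heval : aeval (genericPt Q) h = 0 := (aeval_genericPt_eq_zero_iff Q h).2 hmem
  have hval : ∑ i, (m i : zeroLocusFunctionField Q) * genericPt Q (Sum.inl i) =
      algebraMap F (zeroLocusFunctionField Q) c := by
    simp only [hh, map_sub, map_sum, map_mul, aeval_C, aeval_X, sub_eq_zero] at heval
    simpa using heval
  have htr := transcendental_funcMap hQ (hadd m hm)
  have hmap : funcMap hQ (∑ i, (m i : zeroLocusFunctionField P) * genericPt P (Sum.inl i)) =
      ∑ i, (m i : zeroLocusFunctionField Q) * genericPt Q (Sum.inl i) := by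
    simp [map_sum, map_mul, funcMap_genericPt]
  rw [hmap, hval] at htr
  exact htr (isAlgebraic_algebraMap c)

include hQ in
/-- **Multiplicative freeness of the component**: if every non-trivial Laurent monomial in the
multiplicative coordinates of the generic point `ζ` of `Z(P)` is transcendental over `k`, then
`Z(Q) ∩ Gⁿ` is multiplicatively free. [cite: BaysKirby2018ANT, Prop. 7.3 (proof)] -/
theorem isMulFree_component (hY : ∀ i, (X (Sum.inr i) : MvPolynomial (Fin n ⊕ Fin n) k) ∉ P)
    (hmul : ∀ m : Fin n → ℤ, m ≠ 0 →
      Transcendental k (∏ i, genericPt P (Sum.inr i) ^ m i)) :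
    IsMulFree F n (zeroLocus F Q ∩ torusLocus F n) := by
  classical
  intro m hm ⟨c, hc⟩
  have hne := component_inter_torusLocus_nonempty hQ hY
  -- read the monomial as the first multiplicative coordinate of `[M]`, `M` with first row `m`
  obtain ⟨i₀⟩ : Nonempty (Fin n) := by
    by_contra h0
    rw [not_nonempty_iff] at h0
    exact hm (funext fun i => (h0.false i).elim)
  let M : Matrix (Fin n) (Fin n) ℤ := fun i j => if i = i₀ then m j else 0
  have hM : ∀ (E : Type u) [Field E] (z : Fin n ⊕ Fin n → E),
      matrixAct M z (Sum.inr i₀) = ∏ j, z (Sum.inr j) ^ m j := by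
    intro E _ z
    simp [matrixAct_inr, M]
  -- `Y_{i₀} - c` vanishes on `[M](Z(Q) ∩ Gⁿ)`
  have hvan : (X (Sum.inr i₀) - C c : MvPolynomial (Fin n ⊕ Fin n) F) ∈
      vanishingIdeal F (matrixAct M '' (zeroLocus F Q ∩ torusLocus F n)) := by
    rw [mem_vanishingIdeal_iff]
    rintro _ ⟨z, hz, rfl⟩
    simp only [map_sub, aeval_X, aeval_C, hM F z, hc z hz]
    simp
  rw [vanishingIdeal_image_matrixAct_eq_ker Q (isGenericPt_genericPt Q) hne M, RingHom.mem_ker]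
    at hvan
  have hval : ∏ j, genericPt Q (Sum.inr j) ^ m j = algebraMap F (zeroLocusFunctionField Q) c := by
    have h := hvan
    simp only [map_sub, aeval_X, aeval_C, hM _ (genericPt Q), sub_eq_zero] at h
    simpa using h
  have htr := transcendental_funcMap hQ (hmul m hm)
  have hmap : funcMap hQ (∏ j, genericPt P (Sum.inr j) ^ m j) =
      ∏ j, genericPt Q (Sum.inr j) ^ m j := by
    simp [map_prod, map_zpow₀, funcMap_genericPt]
  rw [hmap, hval] at htr
  exact htr (isAlgebraic_algebraMap c)

end Component

/-! ### Feeding the hypotheses: generic points in a field, and change of the base field -/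

section GenericTransfer

variable {n : ℕ} (P : Ideal (MvPolynomial (Fin n ⊕ Fin n) k)) [P.IsPrime]
variable {E : Type*} [Field E] [Algebra k E] {ζ : Fin n ⊕ Fin n → E}

/-- The `k`-algebra map `k[Z(P)] → E` onto `k[ζ]`, `ζ` a generic point of `Z(P)` in a field `E`.
[folklore] -/
def coordLift (hζ : IsGenericPt P ζ) : zeroLocusCoordRing P →ₐ[k] E :=
  Ideal.Quotient.liftₐ P (aeval ζ : MvPolynomial (Fin n ⊕ Fin n) k →ₐ[k] E)
    (by intro a ha; exact (hζ a).2 ha)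

omit [P.IsPrime] in
/-- `coordLift` is injective (`I(ζ/k) = P`). [folklore] -/
theorem coordLift_injective (hζ : IsGenericPt P ζ) : Function.Injective (coordLift P hζ) := by
  have h : Function.Injective (Ideal.Quotient.lift P
      ((aeval ζ : MvPolynomial (Fin n ⊕ Fin n) k →ₐ[k] E) : MvPolynomial (Fin n ⊕ Fin n) k →+* E)
      (by intro a ha; exact (hζ a).2 ha)) := by
    rw [Ideal.injective_lift_iff]
    exact (isGenericPt_iff_ker_eq P ζ).1 hζ
  exact h

/-- **The embedding `k(Z(P)) → E` determined by a generic point `ζ ∈ E^{n ⊕ n}`**, sending the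
canonical generic point to `ζ`. [cite: Zilber2005, §3] -/
def liftOfIsGenericPt (hζ : IsGenericPt P ζ) : zeroLocusFunctionField P →ₐ[k] E :=
  IsFractionRing.liftAlgHom (coordLift_injective P hζ)

/-- `liftOfIsGenericPt` sends the canonical generic point to `ζ`. [folklore] -/
@[simp] theorem liftOfIsGenericPt_genericPt (hζ : IsGenericPt P ζ) (j : Fin n ⊕ Fin n) :
    liftOfIsGenericPt P hζ (genericPt P j) = ζ j := by
  simp only [liftOfIsGenericPt, genericPt, IsFractionRing.coe_liftAlgHom,
    IsFractionRing.lift_algebraMap]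
  change coordLift P hζ (Ideal.Quotient.mk P (X j)) = ζ j
  simp [coordLift]

/-- `liftOfIsGenericPt ∘ genericPt P = ζ`. [folklore] -/
theorem liftOfIsGenericPt_comp_genericPt (hζ : IsGenericPt P ζ) :
    (liftOfIsGenericPt P hζ) ∘ genericPt P = ζ :=
  funext (liftOfIsGenericPt_genericPt P hζ)

/-- `liftOfIsGenericPt` commutes with the torus action. [folklore] -/
theorem liftOfIsGenericPt_matrixAct (hζ : IsGenericPt P ζ) (M : Matrix (Fin n) (Fin n) ℤ)
    (c : Fin n ⊕ Fin n) :
    liftOfIsGenericPt P hζ (matrixAct M (genericPt P) c) = matrixAct M ζ c := by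
  have h := congrFun (map_matrixAct (liftOfIsGenericPt P hζ).toRingHom M (genericPt P)) c
  simp only [AlgHom.toRingHom_eq_coe, AlgHom.coe_toRingHom, Function.comp_apply,
    liftOfIsGenericPt_comp_genericPt] at h
  exact h

/-- Algebraically independent coordinates of `[M] ζ` give algebraically independent coordinates
of `[M]` applied to the canonical generic point. [folklore] -/
theorem algebraicIndependent_matrixAct_genericPt (hζ : IsGenericPt P ζ)
    (M : Matrix (Fin n) (Fin n) ℤ) {r : ℕ} (s : Fin r → Fin n ⊕ Fin n)
    (h : AlgebraicIndependent k fun i => matrixAct M ζ (s i)) :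
    AlgebraicIndependent k fun i => matrixAct M (genericPt P) (s i) := by
  refine AlgebraicIndependent.of_comp (liftOfIsGenericPt P hζ) ?_
  have : (liftOfIsGenericPt P hζ) ∘ (fun i => matrixAct M (genericPt P) (s i)) =
      fun i => matrixAct M ζ (s i) := by
    funext i
    simp only [Function.comp_apply, liftOfIsGenericPt_matrixAct]
  rwa [this]

/-- Transcendence of a `ℤ`-combination of additive coordinates transfers from `ζ` to the canonical
generic point. [folklore] -/
theorem transcendental_sum_genericPt (hζ : IsGenericPt P ζ) (m : Fin n → ℤ)
    (h : Transcendental k (∑ i, (m i : E) * ζ (Sum.inl i))) :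
    Transcendental k (∑ i, (m i : zeroLocusFunctionField P) * genericPt P (Sum.inl i)) := by
  intro halg
  apply h
  have := halg.algHom (liftOfIsGenericPt P hζ)
  simpa [map_sum, map_mul] using this

/-- Transcendence of a Laurent monomial in the multiplicative coordinates transfers from `ζ` to
the canonical generic point. [folklore] -/
theorem transcendental_prod_genericPt (hζ : IsGenericPt P ζ) (m : Fin n → ℤ)
    (h : Transcendental k (∏ i, ζ (Sum.inr i) ^ m i)) :
    Transcendental k (∏ i, genericPt P (Sum.inr i) ^ m i) := by
  intro halg
  apply h
  have := halg.algHom (liftOfIsGenericPt P hζ)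
  simpa [map_prod, map_zpow₀ ((liftOfIsGenericPt P hζ : zeroLocusFunctionField P →+* E))]
    using this

omit [P.IsPrime] in
/-- `Yᵢ ∉ P` iff the generic point has non-zero multiplicative coordinates. [folklore] -/
theorem X_inr_notMem_iff (hζ : IsGenericPt P ζ) (i : Fin n) :
    (X (Sum.inr i) : MvPolynomial (Fin n ⊕ Fin n) k) ∉ P ↔ ζ (Sum.inr i) ≠ 0 := by
  rw [← hζ (X (Sum.inr i)), aeval_X]

end GenericTransfer

section BaseFieldChange

variable {k' : Type u} [Field k'] (θ : k ≃+* k') {n : ℕ}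
  (P : Ideal (MvPolynomial (Fin n ⊕ Fin n) k))

/-- The image `P^θ ⊆ k'[X]` of an ideal under an isomorphism of coefficient fields. [folklore] -/
abbrev idealMapCoeff : Ideal (MvPolynomial (Fin n ⊕ Fin n) k') :=
  P.map (MvPolynomial.mapEquiv (Fin n ⊕ Fin n) θ : MvPolynomial (Fin n ⊕ Fin n) k ≃+*
    MvPolynomial (Fin n ⊕ Fin n) k')

/-- `P^θ` is prime (Mathlib's instance `Ideal.map_isPrime_of_equiv`, recorded as a theorem for
use with `haveI`). [folklore] -/
theorem idealMapCoeff_isPrime [P.IsPrime] : (idealMapCoeff θ P).IsPrime :=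
  inferInstance

/-- The isomorphism of coordinate rings `k[X] ⧸ P ≃ k'[X] ⧸ P^θ`. [folklore] -/
def coordRingEquiv : zeroLocusCoordRing P ≃+* zeroLocusCoordRing (idealMapCoeff θ P) :=
  Ideal.quotientEquiv P (idealMapCoeff θ P)
    (MvPolynomial.mapEquiv (Fin n ⊕ Fin n) θ : MvPolynomial (Fin n ⊕ Fin n) k ≃+*
      MvPolynomial (Fin n ⊕ Fin n) k') rfl

/-- The isomorphism of function fields `k(Z(P)) ≃ k'(Z(P^θ))`. [folklore] -/
def funcFieldEquiv : zeroLocusFunctionField P ≃+* zeroLocusFunctionField (idealMapCoeff θ P) :=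
  IsFractionRing.ringEquivOfRingEquiv (coordRingEquiv θ P)

/-- `coordRingEquiv` on classes of polynomials. [folklore] -/
@[simp] theorem coordRingEquiv_mk (f : MvPolynomial (Fin n ⊕ Fin n) k) :
    coordRingEquiv θ P (Ideal.Quotient.mk P f) =
      Ideal.Quotient.mk (idealMapCoeff θ P) (MvPolynomial.map (θ : k →+* k') f) := rfl

/-- `funcFieldEquiv` sends generic point to generic point. [folklore] -/
@[simp] theorem funcFieldEquiv_genericPt (j : Fin n ⊕ Fin n) :
    funcFieldEquiv θ P (genericPt P j) = genericPt (idealMapCoeff θ P) j := by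
  simp only [funcFieldEquiv, genericPt, IsFractionRing.ringEquivOfRingEquiv_algebraMap,
    coordRingEquiv_mk, map_X]

/-- `funcFieldEquiv` is `θ` on scalars. [folklore] -/
theorem funcFieldEquiv_algebraMap (c : k) :
    funcFieldEquiv θ P (algebraMap k (zeroLocusFunctionField P) c) =
      algebraMap k' (zeroLocusFunctionField (idealMapCoeff θ P)) (θ c) := by
  rw [IsScalarTower.algebraMap_apply k (zeroLocusCoordRing P) (zeroLocusFunctionField P),
    IsScalarTower.algebraMap_apply k' (zeroLocusCoordRing (idealMapCoeff θ P))
      (zeroLocusFunctionField (idealMapCoeff θ P))]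
  simp only [funcFieldEquiv, IsFractionRing.ringEquivOfRingEquiv_algebraMap]
  congr 1
  have h1 : algebraMap k (zeroLocusCoordRing P) c = Ideal.Quotient.mk P (C c) := rfl
  have h2 : algebraMap k' (zeroLocusCoordRing (idealMapCoeff θ P)) (θ c) =
      Ideal.Quotient.mk _ (C (θ c)) := rfl
  rw [h1, h2, coordRingEquiv_mk, map_C]
  rfl

/-- The compatibility square for `funcFieldEquiv` and `θ`. [folklore] -/
theorem funcFieldEquiv_comp_algebraMap :
    (algebraMap k' (zeroLocusFunctionField (idealMapCoeff θ P))).comp θ.toRingHom =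
      (funcFieldEquiv θ P).toRingHom.comp (algebraMap k (zeroLocusFunctionField P)) := by
  ext c
  simp [funcFieldEquiv_algebraMap]

/-- Algebraic independence over `k` of elements of `k(Z(P))` becomes algebraic independence
over `k'` of their images in `k'(Z(P^θ))`. [folklore] -/
theorem algebraicIndependent_funcFieldEquiv {r : ℕ} {v : Fin r → zeroLocusFunctionField P}
    (hv : AlgebraicIndependent k v) : AlgebraicIndependent k' (funcFieldEquiv θ P ∘ v) :=
  hv.ringHom_of_comp_eq θ.toRingHom (funcFieldEquiv θ P).toRingHom θ.surjective
    (funcFieldEquiv θ P).injective (funcFieldEquiv_comp_algebraMap θ P)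

/-- Transcendence over `k` becomes transcendence over `k'`. [folklore] -/
theorem transcendental_funcFieldEquiv {a : zeroLocusFunctionField P} (ha : Transcendental k a) :
    Transcendental k' (funcFieldEquiv θ P a) :=
  ha.ringHom_of_comp_eq θ.toRingHom (funcFieldEquiv θ P).toRingHom θ.surjective
    (funcFieldEquiv θ P).injective (funcFieldEquiv_comp_algebraMap θ P)

/-- `Yᵢ ∉ P^θ` iff `Yᵢ ∉ P`. [folklore] -/
theorem X_inr_notMem_mapCoeff_iff (i : Fin n) :
    (X (Sum.inr i) : MvPolynomial (Fin n ⊕ Fin n) k') ∉ idealMapCoeff θ P ↔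
      (X (Sum.inr i) : MvPolynomial (Fin n ⊕ Fin n) k) ∉ P := by
  have hX : (X (Sum.inr i) : MvPolynomial (Fin n ⊕ Fin n) k') =
      (MvPolynomial.mapEquiv (Fin n ⊕ Fin n) θ) (X (Sum.inr i)) := by
    change X _ = MvPolynomial.map (θ : k →+* k') (X _)
    rw [map_X]
  rw [hX]
  constructor
  · intro h hP
    exact h (Ideal.mem_map_of_mem _ hP)
  · intro h hP'
    apply h
    have := Ideal.mem_comap.2 hP'
    rwa [Ideal.comap_map_of_bijective _ (MvPolynomial.mapEquiv (Fin n ⊕ Fin n) θ).bijective] at this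

/-- The dimension is unchanged: `dim k'[X] ⧸ P^θ = dim k[X] ⧸ P`. [folklore] -/
theorem ringKrullDim_quotient_mapCoeff :
    ringKrullDim (zeroLocusCoordRing (idealMapCoeff θ P)) = ringKrullDim (zeroLocusCoordRing P) :=
  (ringKrullDim_eq_of_ringEquiv (coordRingEquiv θ P)).symm

variable [P.IsPrime]

/-- Rotundity data transfer from `P` to `P^θ`. [folklore] -/
theorem algebraicIndependent_matrixAct_genericPt_mapCoeff (M : Matrix (Fin n) (Fin n) ℤ) {r : ℕ}
    (s : Fin r → Fin n ⊕ Fin n)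
    (h : AlgebraicIndependent k fun i => matrixAct M (genericPt P) (s i)) :
    AlgebraicIndependent k' fun i => matrixAct M (genericPt (idealMapCoeff θ P)) (s i) := by
  have h1 := algebraicIndependent_funcFieldEquiv θ P h
  have h2 : (funcFieldEquiv θ P) ∘ (fun i => matrixAct M (genericPt P) (s i)) =
      fun i => matrixAct M (genericPt (idealMapCoeff θ P)) (s i) := by
    funext i
    have h := congrFun (map_matrixAct (funcFieldEquiv θ P).toRingHom M (genericPt P)) (s i)
    simp only [RingEquiv.toRingHom_eq_coe, RingEquiv.coe_toRingHom, Function.comp_apply] at h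
    simp only [Function.comp_apply, h]
    congr 1
    funext j
    simp
  rwa [h2] at h1

omit [P.IsPrime] in
/-- Additive freeness data transfer from `P` to `P^θ`. [folklore] -/
theorem transcendental_sum_genericPt_mapCoeff (m : Fin n → ℤ)
    (h : Transcendental k (∑ i, (m i : zeroLocusFunctionField P) * genericPt P (Sum.inl i))) :
    Transcendental k' (∑ i, (m i : zeroLocusFunctionField (idealMapCoeff θ P)) *
      genericPt (idealMapCoeff θ P) (Sum.inl i)) := by
  have := transcendental_funcFieldEquiv θ P h
  simpa [map_sum, map_mul] using this

/-- Multiplicative freeness data transfer from `P` to `P^θ`. [folklore] -/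
theorem transcendental_prod_genericPt_mapCoeff (m : Fin n → ℤ)
    (h : Transcendental k (∏ i, genericPt P (Sum.inr i) ^ m i)) :
    Transcendental k' (∏ i, genericPt (idealMapCoeff θ P) (Sum.inr i) ^ m i) := by
  have := transcendental_funcFieldEquiv θ P h
  simpa [map_prod, map_zpow₀] using this

end BaseFieldChange

/-! ### Genericity from transcendence degree -/

section Genericity

variable {n : ℕ} (P : Ideal (MvPolynomial (Fin n ⊕ Fin n) k)) [P.IsPrime]

/-- **A zero of `P` of transcendence degree `≥ trdeg k[X]⧸P` is a generic point**: if
`z ∈ Z(P)(F)` and `trdeg_k (k[X] ⧸ P) ≤ trdeg_k k[z]`, then `I(z/k) = P` — a prime strictly above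
`P` would have smaller transcendence degree (`Literature.RingTheory.KrullDimension.trdeg_quotient_lt`). This is the step "since
`A ◁ F` we have `δ(c/A) ≥ 0`, so `td(c/A) = dim V`; thus `c` is generic in `V` over `A`" of
Bays–Kirby 2018, Lemma 8.3. [cite: BaysKirby2018ANT, Lemma 8.3 (proof)] -/
theorem isGenericPt_of_trdeg_le {z : Fin n ⊕ Fin n → F} (hz : z ∈ zeroLocus F P)
    (hdim : Algebra.trdeg k (zeroLocusCoordRing P) ≤
      Algebra.trdeg k (Algebra.adjoin k (range z))) :
    IsGenericPt P z := by
  classical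
  -- the corestriction `g₀ : k[X] → k[z]` of evaluation at `z`; it kills `P`
  let g₀ : MvPolynomial (Fin n ⊕ Fin n) k →ₐ[k] Algebra.adjoin k (range z) :=
    (aeval z).codRestrict (Algebra.adjoin k (range z)) fun f => by
      rw [Algebra.adjoin_range_eq_range_aeval]; exact ⟨f, rfl⟩
  have hg₀ : Function.Surjective g₀ := by
    rintro ⟨y, hy⟩
    rw [Algebra.adjoin_range_eq_range_aeval] at hy
    obtain ⟨f, rfl⟩ := hy
    exact ⟨f, rfl⟩
  have hg₀_eq : ∀ f, g₀ f = 0 ↔ aeval z f = 0 := fun f => by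
    rw [Subtype.ext_iff]; rfl
  have hPg₀ : ∀ f ∈ P, g₀ f = 0 := fun f hf => (hg₀_eq f).2 ((mem_zeroLocus_iff.1 hz) f hf)
  let g₁ : zeroLocusCoordRing P →ₐ[k] Algebra.adjoin k (range z) := Ideal.Quotient.liftₐ P g₀ hPg₀
  have hg₁ : Function.Surjective g₁ := fun y => by
    obtain ⟨f, rfl⟩ := hg₀ y
    exact ⟨Ideal.Quotient.mk P f, rfl⟩
  set 𝔭 : Ideal (zeroLocusCoordRing P) := RingHom.ker g₁ with h𝔭
  haveI : 𝔭.IsPrime := RingHom.ker_isPrime _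
  by_cases h𝔭0 : 𝔭 = ⊥
  · -- `g₁` is injective: `I(z/k) = P`
    intro f
    constructor
    · intro hf
      have h1 : g₁ (Ideal.Quotient.mk P f) = 0 := by
        change g₀ f = 0
        exact (hg₀_eq f).2 hf
      have h2 : Ideal.Quotient.mk P f ∈ 𝔭 := h1
      rw [h𝔭0, Ideal.mem_bot, Ideal.Quotient.eq_zero_iff_mem] at h2
      exact h2
    · exact fun hf => (mem_zeroLocus_iff.1 hz) f hf
  · -- otherwise `trdeg k[z] ≤ trdeg (A ⧸ 𝔭) < trdeg A`, contradicting `hdim`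
    exfalso
    have hlt := Literature.RingTheory.KrullDimension.trdeg_quotient_lt k (A := zeroLocusCoordRing P) h𝔭0
    let g₂ : (zeroLocusCoordRing P ⧸ 𝔭) →ₐ[k] Algebra.adjoin k (range z) :=
      Ideal.Quotient.liftₐ 𝔭 g₁ fun a ha => ha
    have hg₂ : Function.Surjective g₂ := fun y => by
      obtain ⟨a, rfl⟩ := hg₁ y
      exact ⟨Ideal.Quotient.mk 𝔭 a, rfl⟩
    have hle : Algebra.trdeg k (Algebra.adjoin k (range z)) ≤
        Algebra.trdeg k (zeroLocusCoordRing P ⧸ 𝔭) :=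
      trdeg_le_of_surjective (R := k) (A := zeroLocusCoordRing P ⧸ 𝔭)
        (A' := Algebra.adjoin k (range z)) g₂ hg₂
    exact absurd (hdim.trans hle) (not_le.2 hlt)

end Genericity

end LocusComponents

end Literature.NumberTheory.Transcendental
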